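import Literature.Algebra.Lie.LefschetzTripleIdealsTensor
import Literature.Algebra.Lie.LefschetzTripleFactors
import Literature.Algebra.Lie.WeylCompleteReducibility
import HarnessLib

/-!
# Looijenga–Lunts (1.2) Lemma, the factors of `M ≅ M' ⊗ M''` are Lefschetz modules with `𝔤(𝔞, M') ≅ 𝔤'`, `𝔤(𝔞, M'') ≅ 𝔤''`

Topic `Literature/Algebra/Lie` (namespace `Literature.Algebra.Lie`).  Lane `lit-hodgefound` (Track 2 foundations
library), skeleton seat `lit-hodgefound-skel-1` (generation 44), row **A1-137** of
`run/shared/lean/pub/lit-hodgefound/SKELETON.md`: the ASSEMBLY of A1-135 `LefschetzTripleIdealsTensor.lean` (the tensor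
clause `M ≅ M' ⊗ M''` of the (1.2) Lemma, `𝔤'` acting through `M'`, `𝔤''` through `M'' = Hom_{𝔤'}(M', M)`) with A1-136
`LefschetzTripleFactors.lean` (`(𝔤', h', 𝔞')` is a Lefschetz triple; representations of `𝔤'` are Lefschetz
`𝔞'`-modules with `𝔤(𝔞', ·)` the image of `𝔤'`): the factors `M'`, `M''` ARE Lefschetz modules — for the components
`𝔞'`, `𝔞''` of `𝔞` and the gradings `h'`, `h''` — on which `𝔤'`, `𝔤''` act FAITHFULLY, with `𝔤(𝔞', M') = 𝔤'|_{M'} ≅ 𝔤'`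
and `𝔤(𝔞'', M'') ≅ 𝔤''` ("with `𝔤'` resp. `𝔤''` corresponding to `𝔤(𝔞, M')` resp. `𝔤(𝔞, M'')`"), and every `x ∈ 𝔤`
acts as `x'|_{M'} ⊗ 1 + 1 ⊗ (x'' ∘ ·)` ("compatible with the gradings", "as Lefschetz `𝔞`-modules").  Over an
algebraically closed field of characteristic `0` (A1-135), `M` finite-dimensional.  DEFINITIONS WITH BODIES (the two
representations `restrictRep : 𝔤' → 𝔤𝔩(M')`, `compRep : 𝔤'' → 𝔤𝔩(M'')`) and PROVED theorems; no named fact, no `sorry`,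
no instance, no notation (D-0026 net debt `0`); `LieRing.ofAssociativeRing` FILE-LOCAL as in every parent.

## Source, VERBATIM

E. Looijenga, V. A. Lunts, *A Lie algebra attached to a projective variety*, Invent. Math. **129** (1997) 361–412,
§1 (1.2) (held TeX text `paper:arxiv-alg-geom_9604014`, p0004 L94–L105; proof continued in the PDF text
`paper:arxiv-alg-geom-9604014`, p0007 L1):

> "Lemma. Let `M` be an irreducible Lefschetz `𝔞`-module and let `𝔤(𝔞, M) = 𝔤' × 𝔤''` be a decomposition of Lie
> algebra's. Then this decomposition is graded and there exist irreducible Lefschetz `𝔞`-modules `M'` and `M''` such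
> that `M ≅ M' ⊗ M''` as Lefschetz `𝔞`-modules with `𝔤'` resp. `𝔤''` corresponding to `𝔤(𝔞, M')` resp. `𝔤(𝔞, M'')`.
> Proof. … upon writing `h = (h', h'') ∈ 𝔤' × 𝔤''`, `𝔤^{(i)}` gets a grading from `ad_{h^{(i)}}` … Since `M` is an
> irreducible module of the semisimple Lie algebra `𝔤(𝔞, M)`, it must have the form `M' ⊗ M''` with `M^{(i)}` a
> `𝔤^{(i)}`-module. This is compatible with the gradings. If the rational map `f : 𝔞 → 𝔤_{-2} = 𝔤'_{-2} ⊕ 𝔤''_{-2}` is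
> written `(f', f'')`, then `[h, f] = -2f` implies `[h', f'] = -2f'` and `[h'', f''] = -2f''`. So `M^{(i)}` [is] a
> Lefschetz module of `𝔞` with the stated property."

## Rendering (dictionary; continuing A1-135/A1-136)

* `𝔤 = 𝔤(𝔞, M) = lefschetzLieAlgebra K h 𝔞` with `A : IsLefschetzModule K h 𝔞` (A1-88), its Lefschetz triple
  `(𝔤, h, 𝔞)` = `A.isLefschetzTriple` (A1-101); `I = 𝔤'`, `J = 𝔤''` complementary ideals, both `≠ 0`;
  `h' = lieIdealProj hIJ h`, `𝔞' = 𝔞.map (lieIdealProj hIJ)` (A1-136), and symmetrically for `𝔤''`.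
* "`M^{(i)}` a `𝔤^{(i)}`-module": `restrictRep hM' : I →ₗ⁅K⁆ 𝔤𝔩(M')` (restriction to the `I`-stable `M'`),
  `compRep hNJ : J →ₗ⁅K⁆ 𝔤𝔩(M'')` (composition on the `J`-stable `M'' = N ⊆ Hom(M', M)`); both FAITHFUL for the factors
  of A1-135 (`restrictRep_injective`, `compRep_injective`), so `𝔤' ≅ 𝔤'|_{M'}` etc.
* "`M'` a Lefschetz module of `𝔞` with `𝔤'` corresponding to `𝔤(𝔞, M')`":
  `IsLefschetzModule K (restrictRep hM' h') (𝔞'.map restrictRep)` and `𝔤(𝔞'.map restrictRep, M') = (restrictRep hM').range`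
  (`IsLefschetzModule.isLefschetzModule_restrictRep`); likewise `…_compRep` for `M''`.

## Contents (all proved)

* §1 `map_rangeRestrict_eq_inSubalgebra` (plumbing), **`IsLefschetzTriple.isLefschetzModule_of_lieHom`** (a Lie homomorphism
  `ρ : 𝔤 → 𝔤𝔩(V)` of a Lefschetz triple with `ρ h ≠ 0` makes `(ρ𝔞, V)` a Lefschetz module with `𝔤(ρ𝔞, V) = ρ(𝔤)` —
  A1-106 for bare homomorphisms, via A1-136 `map_of_surjective`).
* §2 `restrictRep` (+ `coe_restrictRep_apply`, **`restrictRep_injective`**), `compRep` (+ `coe_compRep_apply`,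
  **`compRep_injective`**), **`apply_eval_eq_add`** (`x · e(m ⊗ n) = e(x'm ⊗ n) + e(m ⊗ x''n)`).
* §4 `subRep` (+ `coe_subRep_apply`), **`IsLefschetzModule.isLefschetzModule_subRep`** (a `𝔤(𝔞, M)`-submodule
  `W ⊄ M₀` is a Lefschetz module with `𝔤(𝔞|_W, W) = 𝔤(𝔞, M)|_W`) and **`IsLefschetzModule.exists_isCompl_stable`** (every
  `𝔤(𝔞, M)`-submodule has a `𝔤(𝔞, M)`-stable complement — Weyl, the tree) — "when studying Lefschetz modules we may
  restrict ourselves to irreducible ones" (p0004 L90–L91).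
* §3 **`IsLefschetzModule.isLefschetzModule_restrictRep`**, **`IsLefschetzModule.isLefschetzModule_compRep`**,
  `…nonempty_lieEquiv_lefschetzLieAlgebra_restrictRep` / `…_compRep` (`𝔤' ≅ 𝔤(𝔞', M')`, `𝔤'' ≅ 𝔤(𝔞'', M'')`), and the
  assembled **`IsLefschetzModule.exists_tensor_isLefschetzModule_factors`** (A1-135's `M'`, `M''`, `e` together with
  faithfulness and the two Lefschetz-module structures with `𝔤(𝔞^{(i)}, M^{(i)}) = ` image of `𝔤^{(i)}`).
* §5 (rider, generation 45) **`IsLefschetzModule.exists_tensor_isLefschetzModule_factors_irreducible`**: the same with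
  the IRREDUCIBILITY of `M'` (under `𝔤'`) and of `M''` (under `𝔤''`), `M' ≠ 0` and `dim M = dim M' · dim M''` carried
  along from A1-135 ("there exist irreducible Lefschetz `𝔞`-modules `M'` and `M''`").

## SCOPE

(a) `K` algebraically closed is assumed for the existence of the decomposition (A1-135; necessary).  (b) The
irreducibility of `M'`, `M''` is carried (§5) as the `𝔤'`- resp. `𝔤''`-irreducibility of A1-135 (equivalently
irreducibility over `𝔤(𝔞', M') = 𝔤'|_{M'}`, i.e. as Lefschetz modules, A1-138); the isomorphisms `𝔤' ≅ 𝔤(𝔞', M')` are `LieEquiv.ofInjective` (existence stated as `Nonempty`).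
(c) Nothing here concerns complex tori or the Hodge conjecture.

## References

* [LooijengaLunts1997] E. Looijenga, V. A. Lunts, *A Lie algebra attached to a projective variety*, Invent. Math.
  129 (1997) 361–412; arXiv:alg-geom/9604014. §1 (1.2) Lemma and proof, p. 4 L94–L105 of the held TeX text
  (continued: PDF text p. 7 L1); §1 p. 7 L67–L75.
-/

noncomputable section

namespace Literature.Algebra.Lie

open Module Function Set LieModule LieAlgebra
open scoped TensorProduct

-- The commutator Lie ring of `𝔤𝔩(M) = Module.End K M`: Mathlib's reducible NON-instance, enabled file-locally
-- exactly as in `LefschetzModule.lean`.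
attribute [local instance 100] LieRing.ofAssociativeRing

/-! ### §1 A representation `ρ : 𝔤 → 𝔤𝔩(V)` of a Lefschetz triple with `ρ h ≠ 0` gives a Lefschetz module with `𝔤(ρ𝔞, V) = ρ(𝔤)` -/

section LieHom

variable {K : Type*} [Field K] [CharZero K] {L : Type*} [LieRing L] [LieAlgebra K L] [FiniteDimensional K L]
  {V : Type*} [AddCommGroup V] [Module K V] [FiniteDimensional K V] {h : L} {𝔞 : Submodule K L}

omit [CharZero K] [FiniteDimensional K L] [FiniteDimensional K V] in
/-- The image of `𝔞` under `ρ` restricted to its range is the copy of `ρ 𝔞` inside `ρ(𝔤)` (plumbing for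
`IsLefschetzTriple.isLefschetzModule_of_lieHom`). [cite: LooijengaLunts1997, §1 p0007 L67–L75 ("𝔤(𝔞, M) is just the image of 𝔤 in 𝔤𝔩(M)")] -/
theorem map_rangeRestrict_eq_inSubalgebra (ρ : L →ₗ⁅K⁆ Module.End K V) :
    𝔞.map (ρ.rangeRestrict : L →ₗ[K] ρ.range) = inSubalgebra ρ.range (𝔞.map (ρ : L →ₗ[K] Module.End K V)) := by
  ext x
  rw [Submodule.mem_map, mem_inSubalgebra_iff, Submodule.mem_map]
  constructor
  · rintro ⟨a, ha, rfl⟩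
    exact ⟨a, ha, rfl⟩
  · rintro ⟨a, ha, hax⟩
    exact ⟨a, ha, Subtype.ext hax⟩

/-- **A homomorphism `ρ : 𝔤 → 𝔤𝔩(V)` of a Lefschetz triple `(𝔤, h, 𝔞)` with `ρ h ≠ 0` makes `(ρ 𝔞, V)` a Lefschetz
module with `𝔤(ρ 𝔞, V) = ρ(𝔤)`** ("`M` is then a Lefschetz module of `𝔞` … `𝔤(𝔞, M)` is just the image of `𝔤` in
`𝔤𝔩(M)`" — A1-106, here for a bare Lie homomorphism instead of a `LieModule` instance, through A1-136
`IsLefschetzTriple.map_of_surjective` onto `ρ(𝔤)`). [cite: LooijengaLunts1997, §1 p0007 L67–L75] -/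
theorem IsLefschetzTriple.isLefschetzModule_of_lieHom (T : IsLefschetzTriple K h 𝔞) (ρ : L →ₗ⁅K⁆ Module.End K V)
    (h0 : ρ h ≠ 0) :
    IsLefschetzModule K (ρ h) (𝔞.map (ρ : L →ₗ[K] Module.End K V)) ∧
      lefschetzLieAlgebra K (ρ h) (𝔞.map (ρ : L →ₗ[K] Module.End K V)) = ρ.range := by
  haveI : FiniteDimensional K ρ.range := inferInstanceAs (FiniteDimensional K ρ.range.toSubmodule)
  have h0' : ρ.rangeRestrict h ≠ 0 := fun h1 ↦ h0 (by simpa using congrArg Subtype.val h1)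
  have T' := T.map_of_surjective ρ.rangeRestrict ρ.surjective_rangeRestrict h0'
  rw [map_rangeRestrict_eq_inSubalgebra] at T'
  have hG𝔞 : 𝔞.map (ρ : L →ₗ[K] Module.End K V) ≤ ρ.range.toSubmodule := by
    rintro _ ⟨a, -, rfl⟩
    exact LieHom.mem_range_self ρ a
  exact ⟨T'.isLefschetzModule_of_lieSubalgebra ρ.range hG𝔞, T'.lefschetzLieAlgebra_eq_of_lieSubalgebra ρ.range hG𝔞⟩

end LieHom

/-! ### §2 The representations of `𝔤'` on `M'` (restriction) and of `𝔤''` on `M'' = Hom_{𝔤'}(M', M)` (composition) -/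

section Reps

variable {K : Type*} [Field K] {M : Type*} [AddCommGroup M] [Module K M]
  {𝔤 : LieSubalgebra K (Module.End K M)} {I J : LieIdeal K 𝔤} {M' : Submodule K M}

/-- **`𝔤'` acts on `M'`** (an `I`-stable subspace) by restriction: a Lie algebra homomorphism `I → 𝔤𝔩(M')`.
[cite: LooijengaLunts1997, §1 (1.2) Lemma p0004 L94–L105 ("M' ⊗ M'' with M^{(i)} a 𝔤^{(i)}-module")] -/
def restrictRep (hM' : ∀ x ∈ I, M' ≤ M'.comap ((x : 𝔤) : Module.End K M)) : I →ₗ⁅K⁆ Module.End K M' where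
  toFun x := ((x : 𝔤) : Module.End K M).restrict fun m hm ↦ hM' x x.2 hm
  map_add' x y := LinearMap.ext fun m ↦ Subtype.ext rfl
  map_smul' c x := LinearMap.ext fun m ↦ Subtype.ext rfl
  map_lie' {x y} := LinearMap.ext fun m ↦ Subtype.ext (by
    simp only [LinearMap.restrict_apply]
    rfl)

/-- The restricted action in coordinates. [cite: LooijengaLunts1997, §1 (1.2) Lemma p0004 L94–L105] -/
@[simp] theorem coe_restrictRep_apply (hM' : ∀ x ∈ I, M' ≤ M'.comap ((x : 𝔤) : Module.End K M)) (x : I) (m : M') :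
    (restrictRep hM' x m : M) = ((x : 𝔤) : Module.End K M) m := rfl

/-- **`𝔤'` acts faithfully on `M'`** when `M = M' ⊗ M''` with `𝔤'` acting through the first factor: if `x ∈ 𝔤'`
kills `M'` it kills every `n(m)`, `n ∈ M'' = Hom_{𝔤'}(M', M)`, and these span `M`.
[cite: LooijengaLunts1997, §1 (1.2) Lemma p0004 L94–L105] -/
theorem restrictRep_injective (hM' : ∀ x ∈ I, M' ≤ M'.comap ((x : 𝔤) : Module.End K M))
    {N : Submodule K (M' →ₗ[K] M)}
    (hN : ∀ φ ∈ N, ∀ x ∈ I, ∀ m m' : M', (m' : M) = ((x : 𝔤) : Module.End K M) m →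
      φ m' = ((x : 𝔤) : Module.End K M) (φ m))
    (e : M' ⊗[K] N ≃ₗ[K] M) (he : ∀ (m : M') (φ : N), e (m ⊗ₜ[K] φ) = (φ : M' →ₗ[K] M) m) :
    Function.Injective (restrictRep hM') := by
  intro x y hxy
  rw [← sub_eq_zero] at hxy ⊢
  set z := x - y with hz
  have hz0 : restrictRep hM' z = 0 := by rw [hz, map_sub]; exact hxy
  -- `z` kills every `φ m`, hence `M`
  have h1 : ∀ (m : M') (φ : N), ((z : 𝔤) : Module.End K M) ((φ : M' →ₗ[K] M) m) = 0 := by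
    intro m φ
    have h2 : ((z : 𝔤) : Module.End K M) m = 0 := by
      simpa using congrArg Subtype.val (LinearMap.congr_fun hz0 m)
    have h3 := hN φ φ.2 z z.2 m 0 (by rw [h2]; simp)
    rw [map_zero] at h3
    exact h3.symm
  have h4 : ∀ v : M, ((z : 𝔤) : Module.End K M) v = 0 := by
    intro v
    obtain ⟨t, rfl⟩ := e.surjective v
    induction t using TensorProduct.induction_on with
    | zero => rw [map_zero, map_zero]
    | tmul m φ => rw [he, h1]
    | add a b ha hb => rw [map_add, map_add, ha, hb, add_zero]
  exact Subtype.ext (Subtype.ext (LinearMap.ext fun v ↦ by rw [h4]; rfl))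

variable {N : Submodule K (M' →ₗ[K] M)}

/-- **`𝔤''` acts on `M'' = Hom_{𝔤'}(M', M)`** (a `J`-stable space of maps) by composition: a Lie algebra homomorphism
`J → 𝔤𝔩(M'')`. [cite: LooijengaLunts1997, §1 (1.2) Lemma p0004 L94–L105] -/
def compRep (hNJ : ∀ y ∈ J, ∀ φ ∈ N, ((y : 𝔤) : Module.End K M) ∘ₗ φ ∈ N) : J →ₗ⁅K⁆ Module.End K N where
  toFun y :=
    { toFun := fun φ ↦ ⟨((y : 𝔤) : Module.End K M) ∘ₗ (φ : M' →ₗ[K] M), hNJ y y.2 φ φ.2⟩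
      map_add' := fun φ ψ ↦ Subtype.ext (LinearMap.comp_add _ _ _)
      map_smul' := fun c φ ↦ Subtype.ext (LinearMap.comp_smul _ _ _) }
  map_add' x y := LinearMap.ext fun φ ↦ Subtype.ext (LinearMap.add_comp _ _ _)
  map_smul' c x := LinearMap.ext fun φ ↦ Subtype.ext (LinearMap.smul_comp _ _ _)
  map_lie' {x y} := LinearMap.ext fun φ ↦ Subtype.ext (by
    apply LinearMap.ext
    intro m
    simp only [LinearMap.coe_mk, AddHom.coe_mk, LinearMap.comp_apply]
    rfl)

/-- The composition action in coordinates. [cite: LooijengaLunts1997, §1 (1.2) Lemma p0004 L94–L105] -/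
@[simp] theorem coe_compRep_apply (hNJ : ∀ y ∈ J, ∀ φ ∈ N, ((y : 𝔤) : Module.End K M) ∘ₗ φ ∈ N) (y : J) (φ : N) :
    ((compRep hNJ y φ : N) : M' →ₗ[K] M) = ((y : 𝔤) : Module.End K M) ∘ₗ (φ : M' →ₗ[K] M) := rfl

/-- **`𝔤''` acts faithfully on `M''`** when `M = M' ⊗ M''`: if `y ∈ 𝔤''` kills every `n ∈ M''` then `y(n(m)) = 0`
for all `m`, and the `n(m)` span `M`. [cite: LooijengaLunts1997, §1 (1.2) Lemma p0004 L94–L105] -/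
theorem compRep_injective (hNJ : ∀ y ∈ J, ∀ φ ∈ N, ((y : 𝔤) : Module.End K M) ∘ₗ φ ∈ N)
    (e : M' ⊗[K] N ≃ₗ[K] M) (he : ∀ (m : M') (φ : N), e (m ⊗ₜ[K] φ) = (φ : M' →ₗ[K] M) m) :
    Function.Injective (compRep hNJ) := by
  intro x y hxy
  rw [← sub_eq_zero] at hxy ⊢
  set z := x - y with hz
  have hz0 : compRep hNJ z = 0 := by rw [hz, map_sub]; exact hxy
  have h1 : ∀ (m : M') (φ : N), ((z : 𝔤) : Module.End K M) ((φ : M' →ₗ[K] M) m) = 0 := by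
    intro m φ
    have h2 := congrArg (fun ψ : N ↦ (ψ : M' →ₗ[K] M) m) (LinearMap.congr_fun hz0 φ)
    simpa using h2
  have h4 : ∀ v : M, ((z : 𝔤) : Module.End K M) v = 0 := by
    intro v
    obtain ⟨t, rfl⟩ := e.surjective v
    induction t using TensorProduct.induction_on with
    | zero => rw [map_zero, map_zero]
    | tmul m φ => rw [he, h1]
    | add a b ha hb => rw [map_add, map_add, ha, hb, add_zero]
  exact Subtype.ext (Subtype.ext (LinearMap.ext fun v ↦ by rw [h4]; rfl))

/-- **"`M ≅ M' ⊗ M''` as modules of `𝔤 = 𝔤' × 𝔤''`" — every `x = (x', x'') ∈ 𝔤` acts as `x'|_{M'} ⊗ 1 + 1 ⊗ (x'' ∘ ·)`**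
under `e(m ⊗ n) = n(m)`: `x · e(m ⊗ n) = e(x' m ⊗ n) + e(m ⊗ x'' n)`.  With `x = h` this is "compatible with the
gradings" (`h = (h', h'')`), with `x = e_a`, `a ∈ 𝔞`, it is "as Lefschetz `𝔞`-modules".
[cite: LooijengaLunts1997, §1 (1.2) Lemma and proof, p0004 L94–L105 ("M ≅ M' ⊗ M'' as Lefschetz 𝔞-modules … This is compatible with the gradings")] -/
theorem apply_eval_eq_add (hIJ : IsCompl I J) (hM' : ∀ x ∈ I, M' ≤ M'.comap ((x : 𝔤) : Module.End K M))
    (hN : ∀ φ ∈ N, ∀ x ∈ I, ∀ m m' : M', (m' : M) = ((x : 𝔤) : Module.End K M) m →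
      φ m' = ((x : 𝔤) : Module.End K M) (φ m))
    (hNJ : ∀ y ∈ J, ∀ φ ∈ N, ((y : 𝔤) : Module.End K M) ∘ₗ φ ∈ N)
    (e : M' ⊗[K] N ≃ₗ[K] M) (he : ∀ (m : M') (φ : N), e (m ⊗ₜ[K] φ) = (φ : M' →ₗ[K] M) m)
    (x : 𝔤) (m : M') (φ : N) :
    (x : Module.End K M) (e (m ⊗ₜ[K] φ)) =
      e (restrictRep hM' (lieIdealProj hIJ x) m ⊗ₜ[K] φ) + e (m ⊗ₜ[K] compRep hNJ (lieIdealProj hIJ.symm x) φ) := by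
  rw [he, he, he, coe_compRep_apply, LinearMap.comp_apply,
    hN φ φ.2 (lieIdealProj hIJ x) (lieIdealProj hIJ x).2 m _ (coe_restrictRep_apply hM' _ m),
    ← LinearMap.add_apply]
  congr 1
  exact (congrArg (fun y : 𝔤 ↦ (y : Module.End K M)) (lieIdealProj_add_lieIdealProj hIJ x)).symm

end Reps

/-! ### §3 The factors are Lefschetz modules with `𝔤(𝔞', M') = 𝔤'|M' ≅ 𝔤'`, `𝔤(𝔞'', M'') ≅ 𝔤''` -/

section Factors

variable {K : Type*} [Field K] [CharZero K] {M : Type*} [AddCommGroup M] [Module K M] [FiniteDimensional K M]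
  {h : Module.End K M} {𝔞 : Submodule K (Module.End K M)}
  {I J : LieIdeal K (lefschetzLieAlgebra K h 𝔞)} {M' : Submodule K M} {N : Submodule K (M' →ₗ[K] M)}

/-- **(1.2) Lemma, first factor: `M'` is a Lefschetz module for `𝔞' = ` the `𝔤'`-components of `𝔞` acting by
restriction, graded by `h'`, with `𝔤(𝔞', M') = 𝔤'|_{M'}`** — for a Lefschetz module `(𝔞, M)` (A1-88), a decomposition
`𝔤(𝔞, M) = 𝔤' × 𝔤''` into complementary ideals with `𝔤' ≠ 0`, and an `𝔤'`-stable subspace `M'` on which `𝔤'` acts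
faithfully (as for the factor `M'` of A1-135's `M ≅ M' ⊗ M''`, `restrictRep_injective`).
[cite: LooijengaLunts1997, §1 (1.2) Lemma and proof, p0004 L94–L105 ("there exist irreducible Lefschetz 𝔞-modules M′ and M″ … with 𝔤′ resp. 𝔤″ corresponding to 𝔤(𝔞, M′) resp. 𝔤(𝔞, M″)")] -/
theorem IsLefschetzModule.isLefschetzModule_restrictRep (A : IsLefschetzModule K h 𝔞) (hIJ : IsCompl I J)
    (hI : I ≠ ⊥) (hM' : ∀ x ∈ I, M' ≤ M'.comap ((x : lefschetzLieAlgebra K h 𝔞) : Module.End K M))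
    (hinj : Function.Injective (restrictRep hM')) :
    IsLefschetzModule K (restrictRep hM' (lieIdealProj hIJ ⟨h, A.h_mem⟩))
        (((inSubalgebra (lefschetzLieAlgebra K h 𝔞) 𝔞).map
          (lieIdealProj hIJ : lefschetzLieAlgebra K h 𝔞 →ₗ[K] I)).map (restrictRep hM' : I →ₗ[K] Module.End K M')) ∧
      lefschetzLieAlgebra K (restrictRep hM' (lieIdealProj hIJ ⟨h, A.h_mem⟩))
        (((inSubalgebra (lefschetzLieAlgebra K h 𝔞) 𝔞).map
          (lieIdealProj hIJ : lefschetzLieAlgebra K h 𝔞 →ₗ[K] I)).map (restrictRep hM' : I →ₗ[K] Module.End K M')) =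
        (restrictRep hM').range := by
  haveI : FiniteDimensional K (lefschetzLieAlgebra K h 𝔞) :=
    inferInstanceAs (FiniteDimensional K (lefschetzLieAlgebra K h 𝔞).toSubmodule)
  haveI : FiniteDimensional K I := inferInstanceAs (FiniteDimensional K I.toSubmodule)
  haveI : FiniteDimensional K M' := inferInstance
  have T := (A.isLefschetzTriple).map_lieIdealProj hIJ hI
  refine T.isLefschetzModule_of_lieHom (restrictRep hM') fun h0 ↦ ?_
  exact (A.isLefschetzTriple).lieIdealProj_h_ne_zero hIJ hI (hinj (by rw [h0, map_zero]))

/-- **(1.2) Lemma, second factor: `M'' = Hom_{𝔤'}(M', M)` is a Lefschetz module for the `𝔤''`-components of `𝔞`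
acting by composition, graded by `h''`, with `𝔤(𝔞'', M'') = ` the image of `𝔤''`** (faithful, `compRep_injective`).
[cite: LooijengaLunts1997, §1 (1.2) Lemma and proof, p0004 L94–L105] -/
theorem IsLefschetzModule.isLefschetzModule_compRep (A : IsLefschetzModule K h 𝔞) (hIJ : IsCompl I J)
    (hJ : J ≠ ⊥) (hNJ : ∀ y ∈ J, ∀ φ ∈ N, ((y : lefschetzLieAlgebra K h 𝔞) : Module.End K M) ∘ₗ φ ∈ N)
    (hinj : Function.Injective (compRep hNJ)) :
    IsLefschetzModule K (compRep hNJ (lieIdealProj hIJ.symm ⟨h, A.h_mem⟩))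
        (((inSubalgebra (lefschetzLieAlgebra K h 𝔞) 𝔞).map
          (lieIdealProj hIJ.symm : lefschetzLieAlgebra K h 𝔞 →ₗ[K] J)).map (compRep hNJ : J →ₗ[K] Module.End K N)) ∧
      lefschetzLieAlgebra K (compRep hNJ (lieIdealProj hIJ.symm ⟨h, A.h_mem⟩))
        (((inSubalgebra (lefschetzLieAlgebra K h 𝔞) 𝔞).map
          (lieIdealProj hIJ.symm : lefschetzLieAlgebra K h 𝔞 →ₗ[K] J)).map (compRep hNJ : J →ₗ[K] Module.End K N)) =
        (compRep hNJ).range := by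
  haveI : FiniteDimensional K (lefschetzLieAlgebra K h 𝔞) :=
    inferInstanceAs (FiniteDimensional K (lefschetzLieAlgebra K h 𝔞).toSubmodule)
  haveI : FiniteDimensional K J := inferInstanceAs (FiniteDimensional K J.toSubmodule)
  haveI : FiniteDimensional K M' := inferInstance
  haveI : FiniteDimensional K (M' →ₗ[K] M) := inferInstance
  haveI : FiniteDimensional K N := inferInstance
  have T := (A.isLefschetzTriple).map_lieIdealProj hIJ.symm hJ
  refine T.isLefschetzModule_of_lieHom (compRep hNJ) fun h0 ↦ ?_
  exact (A.isLefschetzTriple).lieIdealProj_h_ne_zero hIJ.symm hJ (hinj (by rw [h0, map_zero]))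

/-- **"`𝔤'` corresponding to `𝔤(𝔞, M')`" as an isomorphism of Lie algebras**: `𝔤' ≅ 𝔤(𝔞', M')` when `𝔤'` acts
faithfully on `M'` (the range of `restrictRep` being `𝔤(𝔞', M')` by `isLefschetzModule_restrictRep`).
[cite: LooijengaLunts1997, §1 (1.2) Lemma p0004 L94–L99] -/
theorem IsLefschetzModule.nonempty_lieEquiv_lefschetzLieAlgebra_restrictRep (A : IsLefschetzModule K h 𝔞)
    (hIJ : IsCompl I J) (hI : I ≠ ⊥) (hM' : ∀ x ∈ I, M' ≤ M'.comap ((x : lefschetzLieAlgebra K h 𝔞) : Module.End K M))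
    (hinj : Function.Injective (restrictRep hM')) :
    Nonempty (I ≃ₗ⁅K⁆ lefschetzLieAlgebra K (restrictRep hM' (lieIdealProj hIJ ⟨h, A.h_mem⟩))
        (((inSubalgebra (lefschetzLieAlgebra K h 𝔞) 𝔞).map
          (lieIdealProj hIJ : lefschetzLieAlgebra K h 𝔞 →ₗ[K] I)).map (restrictRep hM' : I →ₗ[K] Module.End K M'))) := by
  rw [(A.isLefschetzModule_restrictRep hIJ hI hM' hinj).2]
  exact ⟨LieEquiv.ofInjective _ hinj⟩

/-- Likewise `𝔤'' ≅ 𝔤(𝔞'', M'')`. [cite: LooijengaLunts1997, §1 (1.2) Lemma p0004 L94–L99] -/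
theorem IsLefschetzModule.nonempty_lieEquiv_lefschetzLieAlgebra_compRep (A : IsLefschetzModule K h 𝔞)
    (hIJ : IsCompl I J) (hJ : J ≠ ⊥)
    (hNJ : ∀ y ∈ J, ∀ φ ∈ N, ((y : lefschetzLieAlgebra K h 𝔞) : Module.End K M) ∘ₗ φ ∈ N)
    (hinj : Function.Injective (compRep hNJ)) :
    Nonempty (J ≃ₗ⁅K⁆ lefschetzLieAlgebra K (compRep hNJ (lieIdealProj hIJ.symm ⟨h, A.h_mem⟩))
        (((inSubalgebra (lefschetzLieAlgebra K h 𝔞) 𝔞).map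
          (lieIdealProj hIJ.symm : lefschetzLieAlgebra K h 𝔞 →ₗ[K] J)).map (compRep hNJ : J →ₗ[K] Module.End K N))) := by
  rw [(A.isLefschetzModule_compRep hIJ hJ hNJ hinj).2]
  exact ⟨LieEquiv.ofInjective _ hinj⟩

/-- **Looijenga–Lunts (1.2) Lemma, assembled** (over an algebraically closed field of characteristic `0`): for an
irreducible Lefschetz module `(𝔞, M)`, `M ≠ 0`, and a decomposition `𝔤(𝔞, M) = 𝔤' × 𝔤''` into non-zero complementary
ideals, there are `M'` (a `𝔤'`-stable, `𝔤'`-irreducible subspace), `M'' = Hom_{𝔤'}(M', M)` (on which `𝔤''` acts by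
composition, irreducibly) and a linear isomorphism `e : M' ⊗ M'' ≅ M`, `e(m ⊗ n) = n(m)` — so that `𝔤'` acts through
the first and `𝔤''` through the second factor (A1-135) — such that `𝔤'` and `𝔤''` act FAITHFULLY on `M'`, `M''`, and
`(𝔞', M')`, `(𝔞'', M'')` are Lefschetz modules (for the components `𝔞'`, `𝔞''` of `𝔞` and the gradings `h'`, `h''`)
with `𝔤(𝔞', M') = 𝔤'|_{M'} ≅ 𝔤'` and `𝔤(𝔞'', M'') ≅ 𝔤''`.
[cite: LooijengaLunts1997, §1 (1.2) Lemma and proof, p0004 L94–L105] -/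
theorem IsLefschetzModule.exists_tensor_isLefschetzModule_factors [IsAlgClosed K] [Nontrivial M]
    (A : IsLefschetzModule K h 𝔞) [LieModule.IsIrreducible K (lefschetzLieAlgebra K h 𝔞) M]
    (hIJ : IsCompl I J) (hI : I ≠ ⊥) (hJ : J ≠ ⊥) :
    ∃ (M' : Submodule K M) (N : Submodule K (M' →ₗ[K] M)) (e : M' ⊗[K] N ≃ₗ[K] M)
      (hM' : ∀ x ∈ I, M' ≤ M'.comap ((x : lefschetzLieAlgebra K h 𝔞) : Module.End K M))
      (hNJ : ∀ y ∈ J, ∀ φ ∈ N, ((y : lefschetzLieAlgebra K h 𝔞) : Module.End K M) ∘ₗ φ ∈ N),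
      (∀ (m : M') (φ : N), e (m ⊗ₜ[K] φ) = (φ : M' →ₗ[K] M) m) ∧
      Function.Injective (restrictRep hM') ∧ Function.Injective (compRep hNJ) ∧
      (IsLefschetzModule K (restrictRep hM' (lieIdealProj hIJ ⟨h, A.h_mem⟩))
        (((inSubalgebra (lefschetzLieAlgebra K h 𝔞) 𝔞).map
          (lieIdealProj hIJ : lefschetzLieAlgebra K h 𝔞 →ₗ[K] I)).map (restrictRep hM' : I →ₗ[K] Module.End K M')) ∧
        lefschetzLieAlgebra K (restrictRep hM' (lieIdealProj hIJ ⟨h, A.h_mem⟩))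
          (((inSubalgebra (lefschetzLieAlgebra K h 𝔞) 𝔞).map
            (lieIdealProj hIJ : lefschetzLieAlgebra K h 𝔞 →ₗ[K] I)).map (restrictRep hM' : I →ₗ[K] Module.End K M')) =
          (restrictRep hM').range) ∧
      (IsLefschetzModule K (compRep hNJ (lieIdealProj hIJ.symm ⟨h, A.h_mem⟩))
        (((inSubalgebra (lefschetzLieAlgebra K h 𝔞) 𝔞).map
          (lieIdealProj hIJ.symm : lefschetzLieAlgebra K h 𝔞 →ₗ[K] J)).map (compRep hNJ : J →ₗ[K] Module.End K N)) ∧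
        lefschetzLieAlgebra K (compRep hNJ (lieIdealProj hIJ.symm ⟨h, A.h_mem⟩))
          (((inSubalgebra (lefschetzLieAlgebra K h 𝔞) 𝔞).map
            (lieIdealProj hIJ.symm : lefschetzLieAlgebra K h 𝔞 →ₗ[K] J)).map (compRep hNJ : J →ₗ[K] Module.End K N)) =
          (compRep hNJ).range) := by
  obtain ⟨M', N, e, h1, -, -, h4, h5, h6, -, -⟩ := exists_tensor_of_isCompl_lieIdeal_lefschetzLieAlgebra (M := M) hIJ
  have hN : ∀ φ ∈ N, ∀ x ∈ I, ∀ m m' : M', (m' : M) = ((x : lefschetzLieAlgebra K h 𝔞) : Module.End K M) m →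
      φ m' = ((x : lefschetzLieAlgebra K h 𝔞) : Module.End K M) (φ m) := fun φ hφ ↦ (h4 φ).1 hφ
  have hinj1 := restrictRep_injective h1 hN e h5
  have hinj2 := compRep_injective h6 e h5
  exact ⟨M', N, e, h1, h6, h5, hinj1, hinj2, A.isLefschetzModule_restrictRep hIJ hI h1 hinj1,
    A.isLefschetzModule_compRep hIJ hJ h6 hinj2⟩

end Factors

/-! ### §4 "We may restrict ourselves to irreducible ones": `𝔤(𝔞, M)`-submodules are Lefschetz modules and have invariant complements -/

section Submodules

variable {K : Type*} [Field K] {M : Type*} [AddCommGroup M] [Module K M]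
  {𝔤 : LieSubalgebra K (Module.End K M)} {W : Submodule K M}

/-- `𝔤 ⊆ 𝔤𝔩(M)` acts on a `𝔤`-stable subspace `W` by restriction: a Lie algebra homomorphism `𝔤 → 𝔤𝔩(W)`.
[cite: LooijengaLunts1997, §1 (1.2) p0004 L90–L91 ("when studying Lefschetz modules we may restrict ourselves to irreducible ones")] -/
def subRep (hW : ∀ x ∈ 𝔤, W ≤ W.comap x) : 𝔤 →ₗ⁅K⁆ Module.End K W where
  toFun x := (x : Module.End K M).restrict fun m hm ↦ hW x x.2 hm
  map_add' x y := LinearMap.ext fun m ↦ Subtype.ext rfl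
  map_smul' c x := LinearMap.ext fun m ↦ Subtype.ext rfl
  map_lie' {x y} := LinearMap.ext fun m ↦ Subtype.ext (by
    simp only [LinearMap.restrict_apply]
    rfl)

/-- The restricted action in coordinates. [cite: LooijengaLunts1997, §1 (1.2) p0004 L90–L91] -/
@[simp] theorem coe_subRep_apply (hW : ∀ x ∈ 𝔤, W ≤ W.comap x) (x : 𝔤) (w : W) :
    (subRep hW x w : M) = (x : Module.End K M) w := rfl

variable [CharZero K] [FiniteDimensional K M] {h : Module.End K M} {𝔞 : Submodule K (Module.End K M)}

/-- **A `𝔤(𝔞, M)`-submodule of a Lefschetz module is a Lefschetz module** (for `𝔞|_W` and the grading `h|_W`), with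
`𝔤(𝔞|_W, W) = 𝔤(𝔞, M)|_W`, provided `h` does not vanish on `W` (i.e. `W ⊄ M₀`; a `𝔤`-stable `W ⊆ M₀` carries the zero
action).  This is the reduction "when studying Lefschetz modules we may restrict ourselves to irreducible ones", by
A1-106 through `IsLefschetzTriple.isLefschetzModule_of_lieHom`. [cite: LooijengaLunts1997, §1 (1.2) p0004 L90–L91] -/
theorem IsLefschetzModule.isLefschetzModule_subRep (A : IsLefschetzModule K h 𝔞) {W : Submodule K M}
    (hW : ∀ x ∈ lefschetzLieAlgebra K h 𝔞, W ≤ W.comap x) (h0 : ∃ w ∈ W, h w ≠ 0) :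
    IsLefschetzModule K (subRep hW ⟨h, A.h_mem⟩)
        ((inSubalgebra (lefschetzLieAlgebra K h 𝔞) 𝔞).map
          (subRep hW : lefschetzLieAlgebra K h 𝔞 →ₗ[K] Module.End K W)) ∧
      lefschetzLieAlgebra K (subRep hW ⟨h, A.h_mem⟩)
        ((inSubalgebra (lefschetzLieAlgebra K h 𝔞) 𝔞).map
          (subRep hW : lefschetzLieAlgebra K h 𝔞 →ₗ[K] Module.End K W)) = (subRep hW).range := by
  haveI : FiniteDimensional K (lefschetzLieAlgebra K h 𝔞) :=
    inferInstanceAs (FiniteDimensional K (lefschetzLieAlgebra K h 𝔞).toSubmodule)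
  haveI : FiniteDimensional K W := inferInstance
  refine A.isLefschetzTriple.isLefschetzModule_of_lieHom (subRep hW) fun h1 ↦ ?_
  obtain ⟨w, hw, hw0⟩ := h0
  exact hw0 (by simpa using congrArg Subtype.val (LinearMap.congr_fun h1 ⟨w, hw⟩))

/-- **Every `𝔤(𝔞, M)`-submodule of a Lefschetz module has a `𝔤(𝔞, M)`-stable complement** (`𝔤(𝔞, M)` is semisimple;
Weyl's theorem, the tree's `exists_isCompl_lieSubmodule_of_isSemisimple`) — so a Lefschetz module is a direct sum of
irreducible ones: "The preceding discussion showed that when studying Lefschetz modules we may restrict ourselves to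
irreducible ones." [cite: LooijengaLunts1997, §1 (1.2) p0004 L65–L66 ("any representation of a semisimple Lie algebra is reductive"), L90–L91] -/
theorem IsLefschetzModule.exists_isCompl_stable (A : IsLefschetzModule K h 𝔞) {W : Submodule K M}
    (hW : ∀ x ∈ lefschetzLieAlgebra K h 𝔞, W ≤ W.comap x) :
    ∃ W' : Submodule K M, IsCompl W W' ∧ ∀ x ∈ lefschetzLieAlgebra K h 𝔞, W' ≤ W'.comap x := by
  haveI : FiniteDimensional K (lefschetzLieAlgebra K h 𝔞) :=
    inferInstanceAs (FiniteDimensional K (lefschetzLieAlgebra K h 𝔞).toSubmodule)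
  haveI := A.isSemisimple
  let P : LieSubmodule K (lefschetzLieAlgebra K h 𝔞) M :=
    { W with
      lie_mem := fun {x m} hm ↦ by
        rw [LieSubalgebra.coe_bracket_of_module, Module.End.lie_apply]
        exact hW x x.2 hm }
  obtain ⟨Q, hPQ⟩ := exists_isCompl_lieSubmodule_of_isSemisimple (k := K) P
  refine ⟨Q.toSubmodule, LieSubmodule.isCompl_toSubmodule.2 hPQ, fun x hx w hw ↦ ?_⟩
  have h1 := Q.lie_mem (x := ⟨x, hx⟩) hw
  rwa [LieSubalgebra.coe_bracket_of_module, Module.End.lie_apply] at h1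

end Submodules

/-! ### §5 The assembled (1.2) Lemma WITH the irreducibility of the factors ("there exist irreducible Lefschetz 𝔞-modules M′ and M″") -/

section FactorsIrreducible

variable {K : Type*} [Field K] [CharZero K] {M : Type*} [AddCommGroup M] [Module K M] [FiniteDimensional K M]
  {h : Module.End K M} {𝔞 : Submodule K (Module.End K M)}
  {I J : LieIdeal K (lefschetzLieAlgebra K h 𝔞)}

/-- **Looijenga–Lunts (1.2) Lemma, assembled, with "irreducible"**: as `exists_tensor_isLefschetzModule_factors`, and
in addition `M' ≠ 0` is `𝔤'`-IRREDUCIBLE (its only `𝔤'`-stable subspaces are `0` and `M'`), `M'' = Hom_{𝔤'}(M', M)` is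
`𝔤''`-IRREDUCIBLE (its only non-zero `𝔤''`-stable subspace is `M''`) and `dim M = dim M' · dim M''` — the conjuncts of
A1-135 `exists_tensor_of_isCompl_lieIdeal_lefschetzLieAlgebra` that the assembly of §3 dropped (review of p563485).
Since `𝔤(𝔞', M') = 𝔤'|_{M'}` and `𝔤(𝔞'', M'')` is the image of `𝔤''`, this is irreducibility as Lefschetz modules
(p0004 L69–L70, A1-137 §4 / A1-138). [cite: LooijengaLunts1997, §1 (1.2) Lemma, p0004 L94–L100 ("there exist irreducible Lefschetz 𝔞-modules M′ and M″ such that M ≅ M′ ⊗ M″")] -/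
theorem IsLefschetzModule.exists_tensor_isLefschetzModule_factors_irreducible [IsAlgClosed K] [Nontrivial M]
    (A : IsLefschetzModule K h 𝔞) [LieModule.IsIrreducible K (lefschetzLieAlgebra K h 𝔞) M]
    (hIJ : IsCompl I J) (hI : I ≠ ⊥) (hJ : J ≠ ⊥) :
    ∃ (M' : Submodule K M) (N : Submodule K (M' →ₗ[K] M)) (e : M' ⊗[K] N ≃ₗ[K] M)
      (hM' : ∀ x ∈ I, M' ≤ M'.comap ((x : lefschetzLieAlgebra K h 𝔞) : Module.End K M))
      (hNJ : ∀ y ∈ J, ∀ φ ∈ N, ((y : lefschetzLieAlgebra K h 𝔞) : Module.End K M) ∘ₗ φ ∈ N),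
      (∀ (m : M') (φ : N), e (m ⊗ₜ[K] φ) = (φ : M' →ₗ[K] M) m) ∧
      M' ≠ ⊥ ∧
      (∀ W : Submodule K M, W ≤ M' →
        (∀ x ∈ I, W ≤ W.comap ((x : lefschetzLieAlgebra K h 𝔞) : Module.End K M)) → W = ⊥ ∨ W = M') ∧
      (∀ φ : M' →ₗ[K] M, φ ∈ N ↔ ∀ x ∈ I, ∀ m m' : M',
        (m' : M) = ((x : lefschetzLieAlgebra K h 𝔞) : Module.End K M) m →
          φ m' = ((x : lefschetzLieAlgebra K h 𝔞) : Module.End K M) (φ m)) ∧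
      (∀ N₀ : Submodule K (M' →ₗ[K] M), N₀ ≤ N → N₀ ≠ ⊥ →
        (∀ y ∈ J, ∀ φ ∈ N₀, ((y : lefschetzLieAlgebra K h 𝔞) : Module.End K M) ∘ₗ φ ∈ N₀) → N₀ = N) ∧
      finrank K M = finrank K M' * finrank K N ∧
      Function.Injective (restrictRep hM') ∧ Function.Injective (compRep hNJ) ∧
      (IsLefschetzModule K (restrictRep hM' (lieIdealProj hIJ ⟨h, A.h_mem⟩))
        (((inSubalgebra (lefschetzLieAlgebra K h 𝔞) 𝔞).map
          (lieIdealProj hIJ : lefschetzLieAlgebra K h 𝔞 →ₗ[K] I)).map (restrictRep hM' : I →ₗ[K] Module.End K M')) ∧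
        lefschetzLieAlgebra K (restrictRep hM' (lieIdealProj hIJ ⟨h, A.h_mem⟩))
          (((inSubalgebra (lefschetzLieAlgebra K h 𝔞) 𝔞).map
            (lieIdealProj hIJ : lefschetzLieAlgebra K h 𝔞 →ₗ[K] I)).map (restrictRep hM' : I →ₗ[K] Module.End K M')) =
          (restrictRep hM').range) ∧
      (IsLefschetzModule K (compRep hNJ (lieIdealProj hIJ.symm ⟨h, A.h_mem⟩))
        (((inSubalgebra (lefschetzLieAlgebra K h 𝔞) 𝔞).map
          (lieIdealProj hIJ.symm : lefschetzLieAlgebra K h 𝔞 →ₗ[K] J)).map (compRep hNJ : J →ₗ[K] Module.End K N)) ∧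
        lefschetzLieAlgebra K (compRep hNJ (lieIdealProj hIJ.symm ⟨h, A.h_mem⟩))
          (((inSubalgebra (lefschetzLieAlgebra K h 𝔞) 𝔞).map
            (lieIdealProj hIJ.symm : lefschetzLieAlgebra K h 𝔞 →ₗ[K] J)).map (compRep hNJ : J →ₗ[K] Module.End K N)) =
          (compRep hNJ).range) := by
  obtain ⟨M', N, e, h1, h2, h3, h4, h5, h6, h7, h8⟩ :=
    exists_tensor_of_isCompl_lieIdeal_lefschetzLieAlgebra (M := M) hIJ
  have hN : ∀ φ ∈ N, ∀ x ∈ I, ∀ m m' : M', (m' : M) = ((x : lefschetzLieAlgebra K h 𝔞) : Module.End K M) m →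
      φ m' = ((x : lefschetzLieAlgebra K h 𝔞) : Module.End K M) (φ m) := fun φ hφ ↦ (h4 φ).1 hφ
  have hinj1 := restrictRep_injective h1 hN e h5
  have hinj2 := compRep_injective h6 e h5
  exact ⟨M', N, e, h1, h6, h5, h2, h3, h4, h7, h8, hinj1, hinj2, A.isLefschetzModule_restrictRep hIJ hI h1 hinj1,
    A.isLefschetzModule_compRep hIJ hJ h6 hinj2⟩

end FactorsIrreducible

end Literature.Algebra.Lie
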